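import Summits.AnomalousDissipation.AnomalousDissipation.Theorems.SolenoidalFractalHomogenisationLagrangianStepCellChainLinks
import Literature.Analysis.FluidPDE.PassiveVectorTensorModalAdjointCoeff
import HarnessLib

/-!
# K1L_D `LagrangianRenormalisationStepDesign` (stmt-AnomalousDissipation-27980), W7 engine sub-piece S1a / `stub_cellLawV0_IS` V0:
# the CHAIN RIGHT-HAND SIDE and the continuous MODE REPRESENTATIVE of a weak solution of the flat tensor cell problem
# (shared definitions; reviewed; `--kind definition --supports stmt-AnomalousDissipation-27980 --as helper`)

Summits-side definitions file of route `SolenoidalFractalHomogenisation` (prover seat `ad-k1l-cellLawV-w1` g4; W7 engine plan of record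
planner ad-ideate-p4 g13 `Cruxes/LagrangianRenormalisationStep/Lines/onelevel-W7-threemode.md` §5 S1, interface agreed on the cell STATUS board
2026-08-28T21:35–21:45Z with the assembly owner ad-sawtooth-k1loc-p1 g11, p4 g13, p5 g10).  Three definitions with bodies, no theorems beyond
unfolding lemmas, no named facts, no sorry.  For a lattice word `W₁`, a cell number `n`, a constant viscosity tensor `𝔹` and a weak solution
`u` of `∂ₜu + (b·∇)u + ∇π = 𝓛_𝔹 u`, `∇·u = 0` along the cell carrier `b = W₁.cell n` (`Torus.IsWeakTensorPassiveVectorOn 0 T 𝔹 (W₁.cell n) F u`;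
for `ClassDecayW` / `HighLabelDecayW` / `SlowVectorClauseNoExF`: `W₁ = (W.stretch M).stretch (1/ν)`, `𝔹 = (1/n²)•𝔸`, `cellField_eq_cell`):

* `linkCoeff W₁ n k j τ = 2πi (êⱼ·k) · (1/n)·trapⱼ(τ)` — the LINK COEFFICIENT of slot `j` at frequency `k` (constant along the chain `k + ℤKⱼ`,
  `CellChainLinks.sum_e_mul_sub_cellFreq`);
* `modeRHS W₁ n 𝔹 u k τ` — the CHAIN RIGHT-HAND SIDE of mode `k` at time `τ`, read on the a.e.-defined Fourier coefficients `û(τ) = 𝓕(complexify ∘ u τ)`: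
  `−4π² P_k T_{𝔹ᵀ}(k) û(τ)(k) − Σⱼ linkCoeffⱼ(k,τ) • P_k (aⱼ • û(τ)(k − Kⱼ) + a′ⱼ • û(τ)(k + Kⱼ))`
  (`P_k = Torus.transversalProj k` the Leray projection, `T_{𝔹ᵀ}(k) = Torus.symbT (Torus.majorTranspose 𝔹) k` the FORWARD symbol matrix —
  the adjoint of the tree's transposed symbol `symbT 𝔹 k`, `PassiveVectorTensorDuality.inner_symbT_majorTranspose_left` — so that the viscous part is
  `−Torus.modalAdjGen (majorTranspose 𝔹) k`; `Kⱼ i = mⱼ i · n`, `aⱼ = e^{iφⱼ}/(2·(2π|mⱼ|)·i)`, `a′ⱼ = conj aⱼ` written out as in K2R's files);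
* `modeRep W₁ n 𝔹 F u k t = P_k F̂(k) + ∫₀ᵗ modeRHS … k τ dτ` — the continuous (absolutely continuous) REPRESENTATIVE of the mode `t ↦ û(t)(k)`.
The facts (`modeRep = û` a.e., transversality, a.e. `HasDerivAt`, absolute continuity, the gauged three-mode shape `dW0C/dWpC/dWmC` inside a slot) are
proved in `…CellChainModes`.  NOT a proof of anything; rung F-D1.A0 infrastructure.
-/

set_option linter.dupNamespace false

noncomputable section

namespace Summit.AnomalousDissipation.AnomalousDissipation.Theorems.SolenoidalFractalHomogenisation.LagrangianStep.CellChain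

open Set MeasureTheory Complex UnitAddTorus
open scoped InnerProductSpace
open Literature.Analysis Literature.Analysis.FunctionSpaces Literature.Analysis.FunctionSpaces.Torus
open Literature.Analysis.FluidPDE Literature.Analysis.FluidPDE.LatticeShear

variable {k₀ : ℕ}

/-- **The link coefficient** of slot `j` at frequency `k` and time `τ`: `2πi (êⱼ·k) · (1/n)·trapⱼ(fract(τ/P)·P)` (the factor of the two chain
neighbours `k ∓ Kⱼ` in the chain ODE `CellChainLinks.ae_inner_mFourierCoeff_eq_cell`). [cite: MeshalkinSinai1961, pp. 1700–1705] -/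
def linkCoeff (W₁ : LatticeWord k₀) (n : ℕ) (k : Fin 3 → ℤ) (j : Fin k₀) (τ : ℝ) : ℂ :=
  2 * Real.pi * Complex.I * (∑ a, ((W₁.phase j).e a : ℂ) * (k a)) *
    (((1 / (n : ℝ)) * LatticeWord.trapezoid (W₁.start j) (W₁.phase j).τ W₁.ramp (Int.fract (τ / W₁.period) * W₁.period) : ℝ) : ℂ)

/-- Unfolding `linkCoeff`. [cite: MeshalkinSinai1961, pp. 1700–1705] -/
theorem linkCoeff_def (W₁ : LatticeWord k₀) (n : ℕ) (k : Fin 3 → ℤ) (j : Fin k₀) (τ : ℝ) :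
    linkCoeff W₁ n k j τ = 2 * Real.pi * Complex.I * (∑ a, ((W₁.phase j).e a : ℂ) * (k a)) *
      (((1 / (n : ℝ)) * LatticeWord.trapezoid (W₁.start j) (W₁.phase j).τ W₁.ramp (Int.fract (τ / W₁.period) * W₁.period) : ℝ) : ℂ) := rfl

/-- **The chain right-hand side** of mode `k` at time `τ` of a field `u` along the cell carrier `W₁.cell n` with viscosity tensor `𝔹`, read on the
(a.e.-defined) Fourier coefficients `û(τ) = 𝓕(complexify ∘ u τ)`:
`modeRHS = −4π² • P_k (T_{𝔹ᵀ}(k) û(τ)(k)) − Σⱼ linkCoeffⱼ(k,τ) • P_k (aⱼ • û(τ)(k − Kⱼ) + a′ⱼ • û(τ)(k + Kⱼ))`.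
[cite: MeshalkinSinai1961, pp. 1700–1705] [cite: Frisch1995Turbulence, §9.6.3 eq. (9.57) p. 233] -/
def modeRHS (W₁ : LatticeWord k₀) (n : ℕ) (𝔹 : Torus.Visc4 (Fin 3)) (u : ℝ → UnitAddTorus (Fin 3) → EuclideanSpace ℝ (Fin 3))
    (k : Fin 3 → ℤ) (τ : ℝ) : EuclideanSpace ℂ (Fin 3) :=
  -(((4 * Real.pi ^ 2 : ℝ) : ℂ) • Torus.transversalProj k
      (Torus.symbT (Torus.majorTranspose 𝔹) k (mFourierCoeff (EuclideanSpace.complexify ∘ u τ) k))) -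
    ∑ j, linkCoeff W₁ n k j τ • Torus.transversalProj k
      ((Complex.exp ((W₁.phase j).φ * Complex.I) * (1 / (2 * ((2 * Real.pi * ‖latticeVec (W₁.phase j).m‖ : ℝ) : ℂ) * Complex.I))) •
          mFourierCoeff (EuclideanSpace.complexify ∘ u τ) (k - fun i => (W₁.phase j).m i * n) +
        (starRingEnd ℂ (Complex.exp ((W₁.phase j).φ * Complex.I)) *
            (-(1 / (2 * ((2 * Real.pi * ‖latticeVec (W₁.phase j).m‖ : ℝ) : ℂ) * Complex.I)))) •
          mFourierCoeff (EuclideanSpace.complexify ∘ u τ) (k + fun i => (W₁.phase j).m i * n))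

/-- Unfolding `modeRHS`. [cite: MeshalkinSinai1961, pp. 1700–1705] -/
theorem modeRHS_def (W₁ : LatticeWord k₀) (n : ℕ) (𝔹 : Torus.Visc4 (Fin 3)) (u : ℝ → UnitAddTorus (Fin 3) → EuclideanSpace ℝ (Fin 3))
    (k : Fin 3 → ℤ) (τ : ℝ) :
    modeRHS W₁ n 𝔹 u k τ =
      -(((4 * Real.pi ^ 2 : ℝ) : ℂ) • Torus.transversalProj k
          (Torus.symbT (Torus.majorTranspose 𝔹) k (mFourierCoeff (EuclideanSpace.complexify ∘ u τ) k))) -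
        ∑ j, linkCoeff W₁ n k j τ • Torus.transversalProj k
          ((Complex.exp ((W₁.phase j).φ * Complex.I) * (1 / (2 * ((2 * Real.pi * ‖latticeVec (W₁.phase j).m‖ : ℝ) : ℂ) * Complex.I))) •
              mFourierCoeff (EuclideanSpace.complexify ∘ u τ) (k - fun i => (W₁.phase j).m i * n) +
            (starRingEnd ℂ (Complex.exp ((W₁.phase j).φ * Complex.I)) *
                (-(1 / (2 * ((2 * Real.pi * ‖latticeVec (W₁.phase j).m‖ : ℝ) : ℂ) * Complex.I)))) •
              mFourierCoeff (EuclideanSpace.complexify ∘ u τ) (k + fun i => (W₁.phase j).m i * n)) := rfl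

/-- **The continuous representative of the mode `k`** of a weak solution `u` from the datum `F`:
`modeRep t = P_k F̂(k) + ∫₀ᵗ modeRHS … k τ dτ` (interval integral; the Leray projection of the datum coefficient makes the representative
transversal at `k` for every datum — for a weakly divergence-free `F` it is `F̂(k)` itself). [cite: Temam1984, Ch. III §1.1] -/
def modeRep (W₁ : LatticeWord k₀) (n : ℕ) (𝔹 : Torus.Visc4 (Fin 3)) (F : UnitAddTorus (Fin 3) → EuclideanSpace ℝ (Fin 3))
    (u : ℝ → UnitAddTorus (Fin 3) → EuclideanSpace ℝ (Fin 3)) (k : Fin 3 → ℤ) (t : ℝ) : EuclideanSpace ℂ (Fin 3) :=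
  Torus.transversalProj k (mFourierCoeff (EuclideanSpace.complexify ∘ F) k) + ∫ τ in (0:ℝ)..t, modeRHS W₁ n 𝔹 u k τ

/-- Unfolding `modeRep`. [cite: Temam1984, Ch. III §1.1] -/
theorem modeRep_def (W₁ : LatticeWord k₀) (n : ℕ) (𝔹 : Torus.Visc4 (Fin 3)) (F : UnitAddTorus (Fin 3) → EuclideanSpace ℝ (Fin 3))
    (u : ℝ → UnitAddTorus (Fin 3) → EuclideanSpace ℝ (Fin 3)) (k : Fin 3 → ℤ) (t : ℝ) :
    modeRep W₁ n 𝔹 F u k t =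
      Torus.transversalProj k (mFourierCoeff (EuclideanSpace.complexify ∘ F) k) + ∫ τ in (0:ℝ)..t, modeRHS W₁ n 𝔹 u k τ := rfl

/-- The representative starts at the Leray-projected datum coefficient: `modeRep 0 = P_k F̂(k)`. [cite: Temam1984, Ch. III §1.1] -/
theorem modeRep_zero (W₁ : LatticeWord k₀) (n : ℕ) (𝔹 : Torus.Visc4 (Fin 3)) (F : UnitAddTorus (Fin 3) → EuclideanSpace ℝ (Fin 3))
    (u : ℝ → UnitAddTorus (Fin 3) → EuclideanSpace ℝ (Fin 3)) (k : Fin 3 → ℤ) :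
    modeRep W₁ n 𝔹 F u k 0 = Torus.transversalProj k (mFourierCoeff (EuclideanSpace.complexify ∘ F) k) := by
  rw [modeRep_def, intervalIntegral.integral_same, add_zero]

end Summit.AnomalousDissipation.AnomalousDissipation.Theorems.SolenoidalFractalHomogenisation.LagrangianStep.CellChain

end
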